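import Summits.QuantumFields.BalabanUV.T4Continuum.Support.NE3DiscreteGradientEstimate
import HarnessLib

/-!
# T⁴ programme, row NE7 — (156) THE LATTICE HODGE IDENTITY FOR A BOND FIELD AND THE INTERIOR GRADIENT ESTIMATE IT FEEDS:
# `‖∇A‖ ≤ 2·(d·sup‖A‖∕R + R·(sup‖div dA‖ + sup‖∇ div A‖))` on `ℤᵈ`, for every radius `R ≥ 1` (`NE7LatticeHodgeGradient`)

Cell `pub-balaban`, rung (B)+1 sub-cell t4, row NE7.  Lineage `b2b-balaban-t4-ne7-p2` (CRUX PROVER NE7 #2 = co-owner of row NE7),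
generation 88; first file of the chain (156)–(159) «THE GRADIENT CURRENCY `a₁` OF REP♭ IS NOT AN INDEPENDENT LETTER».

WHY.  After (155) `NE7ApeTrivialFlatEndDischarged.smallField_of_trivialLetters_final`, the (APE) bootstrap at the trivial flat datum
asks of the representative `A₀` (with `U^{u₀} = e^{A₀}`) exactly two currencies: the sup `‖A₀‖ ≤ a₀` and the GRADIENT `‖∇A₀‖ ≤ a₁`
([Balaban1985RegularSpaces] Thm 2 (1.36), first and second clause, TYPE — a hypothesis).  The gradient clause is what an axial gauge
cannot give (lineage gen 87: `a₁ ~ δ∕M` there, not `δ∕M²`).  This file is the LINEAR lattice-calculus reason why a Landau-type gauge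
gives it: the componentwise lattice Laplacian of a bond field (1-form) `A` is, EXACTLY,
  `Σ_i [(A(x+e_i)_ν − A(x)_ν) − (A(x)_ν − A(x−e_i)_ν)] = Σ_μ [dA(x; μ, ν) − dA(x − e_μ; μ, ν)] + [div A(x + e_ν) − div A(x)]`,
`dA(x; μ, ν) = A(x)_μ + A(x+e_μ)_ν − A(x+e_ν)_μ − A(x)_ν` (the lattice exterior derivative = the abelian plaquette functional
`B7Prop1Explicit.asum A x (plaqWord μ ν)`), `div A(x) = Σ_μ (A(x)_μ − A(x−e_μ)_μ)` (= `NE3CoercivityScaling.flatDiv`) — the lattice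
form of `−Δ = δd + dδ` on 1-forms — so that R37's interior gradient estimate `NE3DiscreteGradientEstimate.norm_sub_le_of_laplacian`
([Gilbarg–Trudinger Thm 3.9] on `ℤᵈ`, lineage pub-balaban-gaps ne3 g8) bounds every forward difference of `A` by
`2·(d·U∕R + R·(J + P))` whenever `‖A‖ ≤ U`, `‖Σ_μ [dA(x;μ,ν) − dA(x−e_μ;μ,ν)]‖ ≤ J` (lattice co-differential of the curvature 2-form)
and `‖div A(x+e_ν) − div A(x)‖ ≤ P` (gradient of the divergence = the Landau reaction) on the sup-cube of radius `R`.
With `R = M = L^{k+1}`, `U = a₀ ~ s∕M`, `J ~ c∕M³` (a (1.9)-type flux-divergence bound, supplied at the fibre point by the OWNER's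
R1 `NE7CriticalFirstVariation` + a by-parts dictionary) and `P ~ r∕M³` (Landau smoothness): `‖∇A‖ ≲ (ds + c + r)∕M²` — files (157)–(159).

WHAT ([folklore] lattice calculus; 0 def, 0 sorry; generic coefficients `E`):
* §1 `laplacian_eq_sum_dCurl_add_dDiv` — the identity above, in any additive commutative group `E`.
* §2 `norm_fdiff_le_of_curl_div` — the identity composed with `norm_sub_le_of_laplacian` (local hypotheses on the sup-cube);
  `norm_fdiff_le_of_curl_div_global` — the same with global hypotheses (the form (157) consumes).

HONEST FRAMING (page 1): elementary lattice analysis of OUR objects; nothing of Bałaban's is used or claimed; no gauge field here;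
(APE) NOT proved; NE7 NOT PRINTED ∕ NOT PROVED; spine 0∕9; finite T⁴ rung (B)+1 — NOT infinite volume, NOT mass gap, NOT Clay.
Continuum YM on T⁴ ⇐ BetaPertH ∧ nine spine estimates (0/9 proved); BetaPertH ⇐ (D1) ∧ (D4) ∧ CAP+tail; G-an2-4 gates asym, D1 and NE2/3/4.
No `sorry`; axioms ⊆ {propext, Classical.choice, Quot.sound}.  PLACEMENT: our lemma, under `Summits/QuantumFields/BalabanUV/`;
imports `Support/NE3DiscreteGradientEstimate` only.
-/

set_option autoImplicit false

open scoped BigOperators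
open Finset

namespace Summit.QuantumFields.BalabanUV.T4Continuum.NE7LatticeHodgeGradient

open Literature.MathematicalPhysics.QuantumFieldTheory.Balaban1983to89
open B7Prop1Explicit
open NE3DiscreteGradientEstimate (norm_sub_le_of_laplacian)

variable {d : ℕ}

/-! ## §1 The lattice Hodge identity `−Δ = δd + dδ` on bond fields, componentwise -/

/-- **THE LATTICE HODGE IDENTITY FOR A BOND FIELD, COMPONENTWISE**: for `A : ℤᵈ → (Fin d → E)`, a site `x` and a component `ν`,
`Σ_i [(A(x+e_i)_ν − A(x)_ν) − (A(x)_ν − A(x−e_i)_ν)] = Σ_μ [dA(x;μ,ν) − dA(x−e_μ;μ,ν)] + [div A(x+e_ν) − div A(x)]` with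
`dA(x;μ,ν) = A(x)_μ + A(x+e_μ)_ν − A(x+e_ν)_μ − A(x)_ν` and `div A(x) = Σ_μ (A(x)_μ − A(x−e_μ)_μ)` — the exact lattice form of
`−(ΔA)_ν = (δdA)_ν + (dδA)_ν` (forward exterior derivative, backward co-differential; the `μ = ν` summand of the curl term vanishes).
[folklore] -/
theorem laplacian_eq_sum_dCurl_add_dDiv {E : Type*} [AddCommGroup E] (A : Site d → Fin d → E) (x : Site d) (ν : Fin d) :
    ∑ i, ((A (x + e i) ν - A x ν) - (A x ν - A (x - e i) ν))
      = ∑ μ, ((A x μ + A (x + e μ) ν - A (x + e ν) μ - A x ν)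
              - (A (x - e μ) μ + A (x - e μ + e μ) ν - A (x - e μ + e ν) μ - A (x - e μ) ν))
        + (∑ μ, (A (x + e ν) μ - A (x + e ν - e μ) μ) - ∑ μ, (A x μ - A (x - e μ) μ)) := by
  have h1 : ∀ μ : Fin d, x - e μ + e μ = x := fun μ => sub_add_cancel x (e μ)
  have h2 : ∀ μ : Fin d, x - e μ + e ν = x + e ν - e μ := fun μ => by abel
  simp only [h1, h2, ← Finset.sum_sub_distrib, ← Finset.sum_add_distrib]
  refine Finset.sum_congr rfl fun μ _ => ?_
  abel

/-! ## §2 The interior gradient estimate for a bond field from its curl-divergence and its divergence-gradient -/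

/-- **THE INTERIOR GRADIENT ESTIMATE FOR A BOND FIELD** (local form): if on the sup-cube `{|y_i − x₀,i| ≤ R}` (`R ≥ 1`) the component
`ν` of `A` is bounded by `U`, the lattice co-differential of its curl `Σ_μ [dA(y;μ,ν) − dA(y−e_μ;μ,ν)]` by `J` and the forward difference
of its divergence `div A(y+e_ν) − div A(y)` by `P`, then `‖A(x₀+e_τ)_ν − A(x₀)_ν‖ ≤ 2·(d·U∕R + R·(J + P))` — §1 fed into R37's
`NE3DiscreteGradientEstimate.norm_sub_le_of_laplacian`. [folklore] -/
theorem norm_fdiff_le_of_curl_div {E : Type*} [NormedAddCommGroup E] [NormedSpace ℝ E] (A : Site d → Fin d → E)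
    (x₀ : Site d) (ν τ : Fin d) {R : ℕ} (hR : 1 ≤ R) {U J P : ℝ}
    (hU : ∀ y : Site d, (∀ i, |y i - x₀ i| ≤ (R : ℤ)) → ‖A y ν‖ ≤ U)
    (hJ : ∀ y : Site d, (∀ i, |y i - x₀ i| ≤ (R : ℤ)) →
      ‖∑ μ, ((A y μ + A (y + e μ) ν - A (y + e ν) μ - A y ν)
              - (A (y - e μ) μ + A (y - e μ + e μ) ν - A (y - e μ + e ν) μ - A (y - e μ) ν))‖ ≤ J)
    (hP : ∀ y : Site d, (∀ i, |y i - x₀ i| ≤ (R : ℤ)) →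
      ‖∑ μ, (A (y + e ν) μ - A (y + e ν - e μ) μ) - ∑ μ, (A y μ - A (y - e μ) μ)‖ ≤ P) :
    ‖A (x₀ + e τ) ν - A x₀ ν‖ ≤ 2 * ((d : ℝ) * U / R + R * (J + P)) := by
  refine norm_sub_le_of_laplacian x₀ τ hR (fun y => A y ν) hU fun y hy => ?_
  rw [laplacian_eq_sum_dCurl_add_dDiv A y ν]
  exact (norm_add_le _ _).trans (add_le_add (hJ y hy) (hP y hy))

/-- **THE INTERIOR GRADIENT ESTIMATE FOR A BOND FIELD** (global form): with the three bounds holding at every site, every forward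
difference of every component obeys `‖A(x+e_τ)_ν − A(x)_ν‖ ≤ 2·(d·U∕R + R·(J + P))` for every radius `R ≥ 1` — the trade-off the
chain uses at `R = M`. [folklore] -/
theorem norm_fdiff_le_of_curl_div_global {E : Type*} [NormedAddCommGroup E] [NormedSpace ℝ E] (A : Site d → Fin d → E)
    {R : ℕ} (hR : 1 ≤ R) {U J P : ℝ}
    (hU : ∀ (y : Site d) (ν : Fin d), ‖A y ν‖ ≤ U)
    (hJ : ∀ (y : Site d) (ν : Fin d),
      ‖∑ μ, ((A y μ + A (y + e μ) ν - A (y + e ν) μ - A y ν)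
              - (A (y - e μ) μ + A (y - e μ + e μ) ν - A (y - e μ + e ν) μ - A (y - e μ) ν))‖ ≤ J)
    (hP : ∀ (y : Site d) (ν : Fin d), ‖∑ μ, (A (y + e ν) μ - A (y + e ν - e μ) μ) - ∑ μ, (A y μ - A (y - e μ) μ)‖ ≤ P)
    (x : Site d) (ν τ : Fin d) :
    ‖A (x + e τ) ν - A x ν‖ ≤ 2 * ((d : ℝ) * U / R + R * (J + P)) :=
  norm_fdiff_le_of_curl_div A x ν τ hR (fun y _ => hU y ν) (fun y _ => hJ y ν) (fun y _ => hP y ν)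

end Summit.QuantumFields.BalabanUV.T4Continuum.NE7LatticeHodgeGradient
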